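import Literature.AnabelianGeometry.EtaleTheta.SettingModel2Inversion
import HarnessLib

/-!
# The completed inversion `σ̂` of `F̂₂`, intrinsically: `σ̂(x)·x ∈ closure [F̂₂, F̂₂]` and `ι̂₁ = σ̂ × id`

S. Mochizuki, *The étale theta function and its Frobenioid-theoretic manifestations*, Publ. RIMS **45** (2009) [EtTh], §1 p. 12
(«`Δ_X` … a profinite free group on 2 generators»), §2 p. 36 («`ι` … “multiplication by `−1`”»), Prop. 2.2 (i) p. 37
(«eigenvalues `−1` and `1`»). [cite: MochizukiEtTh2009, Prop 2.2 (i) p.37]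

PROOF-ONLY (no definitions, no `Prop` facts). Cell abc-iut, seat abc-iut-w5-d072 (gen 3; (R1) ι-datum custody; preparation for
the (R1) facets of the χ-twisted root model, R78 cluster). Two facts about `sigmaHat : F̂₂ →ₜ* F̂₂` (`SettingModel2Inversion.lean`,
p428141) stated INSIDE `F̂₂`, so that any root model whose `Δ_X` is identified with `F̂₂` compatibly with `σ̂` inherits (R1e′)
by transport:

* `sigmaHat_mul_self_mem_closure_commutator : ∀ x : F̂₂, σ̂(x)·x ∈ closure [F̂₂, F̂₂]` («`σ̂` acts as `−1` on `F̂₂^ab`»; density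
  of `η(F₂)`, where `σ(g)·g ∈ [F₂, F₂]`);
* `completionAut_inversion_apply : ι̂₁ (x, y) = (σ̂ x, y)` — the extended automorphism of the discrete root model's
  `Π_X = F̂₂ × Ĝ_{ℚ_p}` (p424489) IS `σ̂ × id` (uniqueness of extensions), whence also `ι̂₂ (x, y) = (σ̂ x, y)` for the finer
  model (`completionAut_inversion₂_apply`, via `completionAut_inversion₂_eq`).

Nothing here bears on [IUTchIII] Cor. 3.12; typed ≠ proved.
-/

noncomputable section

namespace Literature.AnabelianGeometry.EtaleTheta.SettingModel

open Literature.AnabelianGeometry.SemiGraphs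
open Function
open _root_.Topology

/-- **`σ̂(x)·x ∈ closure [F̂₂, F̂₂]` for every `x ∈ F̂₂`**: the set of such `x` is closed (continuity) and contains the dense
`η(F₂)` (`σ(g)·g ∈ [F₂, F₂]`, `invGenHom_mul_self_mem_commutator`). [cite: MochizukiEtTh2009, Prop 2.2 (i) p.37] -/
theorem sigmaHat_mul_self_mem_closure_commutator (x : F₂hatT) :
    sigmaHat x * x ∈ (commutator F₂hatT).topologicalClosure := by
  have hS : IsClosed {x : F₂hatT | sigmaHat x * x ∈ (commutator F₂hatT).topologicalClosure} :=
    (Subgroup.isClosed_topologicalClosure _).preimage (sigmaHat.continuous.mul continuous_id)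
  have hsub : Set.range eta ⊆ {x : F₂hatT | sigmaHat x * x ∈ (commutator F₂hatT).topologicalClosure} := by
    rintro _ ⟨g, rfl⟩
    change sigmaHat (eta g) * eta g ∈ (commutator F₂hatT).topologicalClosure
    rw [sigmaHat_eta, ← map_mul]
    refine Subgroup.le_topologicalClosure _ ?_
    have h1 : eta (invGenHom g * g) ∈ (commutator F₂).map eta := ⟨_, invGenHom_mul_self_mem_commutator g, rfl⟩
    rw [commutator_def, Subgroup.map_commutator] at h1
    rw [commutator_def]
    exact Subgroup.commutator_mono le_top le_top h1
  have hx : x ∈ closure (Set.range eta) := by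
    rw [denseRange_eta.closure_range]
    exact Set.mem_univ x
  exact closure_minimal hsub hS hx

variable (p : ℕ) [Fact p.Prime]

/-- **`ι̂₁ = σ̂ × id`**: the extended automorphism of `Π_X = F̂₂ × Ĝ_{ℚ_p}` induced by the discrete root model's inversion
(p424489) is `(x, y) ↦ (σ̂ x, y)` (both are continuous homomorphisms agreeing on the dense image of `Π^tp_X = F₂ × Γ`).
[cite: MochizukiSemiAnbd2006, §6 p.69] -/
theorem completionAut_inversion_apply (z : PiHt p) :
    (ThetaSetting.model p).completionAut (inversion p) z = (sigmaHat z.1, z.2) := by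
  let Φ : PiHt p →ₜ* PiHt p :=
    { toMonoidHom := ((ThetaSetting.model p).completionAut (inversion p)).toMulEquiv.toMonoidHom
      continuous_toFun := ((ThetaSetting.model p).completionAut (inversion p)).continuous }
  let Ψ : PiHt p →ₜ* PiHt p := sigmaHat.prodMap (ContinuousMonoidHom.id (GamHatT p))
  have hΦΨ : Φ = Ψ := by
    refine IsProfiniteCompletion.extension_unique (ThetaSetting.model p).isProfiniteCompletion_toHat Φ Ψ fun x => ?_
    change (ThetaSetting.model p).completionAut (inversion p) ((ThetaSetting.model p).toHat x) =
      (sigmaHat ((ThetaSetting.model p).toHat x).1, ((ThetaSetting.model p).toHat x).2)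
    rw [TemperedCurve.completionAut_toHat]
    change toHatM p (inversion p x) = (sigmaHat (toHatM p x).1, (toHatM p x).2)
    rw [toHatM_apply, toHatM_apply, inversion_apply, Del.val_inv]
    change (eta (invGenHom (Del.val x.1)), etaGam p x.2) = (sigmaHat (eta (Del.val x.1)), etaGam p x.2)
    rw [sigmaHat_eta]
  exact DFunLike.congr_fun (congrArg ContinuousMonoidHom.toMonoidHom hΦΨ) z

/-- **`ι̂₂ = σ̂ × id`** for the finer model as well. [cite: MochizukiSemiAnbd2006, §6 p.69] -/
theorem completionAut_inversion₂_apply (z : PiHt p) :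
    (ThetaSetting.model₂ p).completionAut (inversion₂ p) z = (sigmaHat z.1, z.2) := by
  rw [completionAut_inversion₂_eq, completionAut_inversion_apply]

end Literature.AnabelianGeometry.EtaleTheta.SettingModel

end
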